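import Mathlib.Topology.Algebra.MvPolynomial
import Literature.Computability.AlgebraicComplexity.TensorOrbitClosedOfNoFixedTorus
import Literature.Computability.AlgebraicComplexity.SingularFormsInvariantSeparation
import Literature.Computability.AlgebraicComplexity.PolystabilityProofs
import Literature.Computability.AlgebraicComplexity.MS2001FormEPolystableComplex
import Literature.Computability.AlgebraicComplexity.SmoothFormFiniteStabilizer
import Literature.Computability.AlgebraicComplexity.BI17GenericTernaryCubicPolystable
import Literature.Computability.AlgebraicComplexity.BI17NonNormalOrbitClosuresProofs
import HarnessLib

/-!
# Mumford's stability of smooth forms; Bürgisser–Ikenmeyer 2017, Prop. 2.10 and Cor. 3.17 (discharge)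

P. Bürgisser, C. Ikenmeyer, *Fundamental invariants of orbit closures*, J. Algebra **477** (2017)
390–434 [BurgisserIkenmeyer2017], Prop. 2.10 (`\label{pro:gen-form-stable}`, arXiv:1511.02927
`main.tex` L633; held text `paper:arxiv-1511.02927` p0007:L60): *"If `D > 1`, then almost all
`w ∈ Sym^D ℂ^m` are polystable."* The printed proof ("`D = 2`: all `SL_m`-orbits … are closed;
`D > 2`: Theorem 2.3 and [Luna 1973]") rests on Luna's étale slice theorem. This file DISCHARGES the
typed fact `BI2017_prop_2_10` (`BI17FundamentalInvariantForms.lean`, val-lit row BI2017-A, t04)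
by MUMFORD'S ROUTE instead (Mumford–Fogarty–Kirwan, GIT, Ch. 4 §2 Prop. 4.2: a smooth hypersurface of
degree `≥ 3` is a stable point), assembled from the tree:

* `isPolystable_of_invariant_ne_zero` — **Mumford's theorem in the tree's vocabulary**: a form `F`
  of degree `D ≥ 3` in `n + 2 ≥ 2` variables at which some `SL`-invariant `q` vanishing on all
  singular forms of degree `D` does not vanish (so `F` is nonsingular) is polystable
  (`IsPolystable F`: its `SL_{n+2}(ℂ)`-orbit is Zariski closed). Proof: `q` is constant on the
  orbit, hence (continuity) on its classical closure, so every closure point is a NONSINGULAR form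
  and has a FINITE stabiliser (Matsumura–Monsky over `ℂ`, tree
  `finite_linStabilizer_of_isNonsingularForm`, val-lit t14); therefore no closure point is fixed by a
  non-trivial real one-parameter torus, and the compactness lemma
  `isClosed_tensorOrbit_of_closure_noFixedTorus` (`TensorOrbitClosedOfNoFixedTorus.lean`, applied
  to the symmetric tensor `MS2001Thm73.symTensor D F` of `F`) shows that the orbit is classically
  closed; the tree's bridges `isClosed_image_slOrbit_tensorToPoly` and
  `isPolystable_of_isClosed_image_slOrbit` (`PolystabilityProofs.lean`) turn this into
  `IsPolystable F`.
* `isZariskiGeneric_isPolystable_of_three_le` — for `D ≥ 3` and `n + 2 ≥ 2` variables, almost all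
  forms are polystable: the generic set is `{q ≠ 0}`, `q` the invariant of
  `SingularFormsInvariantSeparation.lean` (`q(ΣX_i^D) = 1`, `q = 0` on singular forms).
* `BI2017_prop_2_10_holds : BI2017_prop_2_10` — with the slices already in the tree (`D = 2`,
  `m ≤ 1`, val-lit p5: `BI2017_prop_2_10_of_residual`).
* `BI2017_cor_3_17_holds : BI2017_cor_3_17` — by the tree's bridge `BI2017_cor_3_17_of_prop_2_10`
  (`BI17NonNormalOrbitClosuresProofs.lean`).

Theorem-only file (no definitions, no named facts). Typed vs printed: the FACT is discharged exactly
as typed; the route is Mumford's (GIT Prop. 4.2 + Matsumura–Monsky), not the printed Luna-slice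
argument, and the full statement "EVERY nonsingular form of degree `≥ 3` is polystable" is proved
here only relative to an invariant `q` with `q(F) ≠ 0` (for all `F` at once this is the discriminant,
which the tree does not construct). Honest framing: classical invariant theory; VP ≠ VNP is NOT
proved and nothing in this file is progress on it.

## References

* [BurgisserIkenmeyer2017] P. Bürgisser, C. Ikenmeyer, J. Algebra 477 (2017), Prop. 2.10, Cor. 3.17.
* [MumfordFogartyKirwan1994] D. Mumford, J. Fogarty, F. Kirwan, *Geometric Invariant Theory*,
  3rd ed. (1994), Ch. 4 §2 Prop. 4.2; Ch. 1 §2 Cor. 1.2; Ch. 2 §1.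
* [Poonen2005] B. Poonen, *Varieties without extra automorphisms III*, Finite Fields Appl. 11 (2005),
  Thm. 2 (Matsumura–Monsky: finite linear automorphism group of a smooth hypersurface, `d ≥ 3`).
-/

noncomputable section

open MvPolynomial Filter
open scoped Topology

namespace Literature.Computability.AlgebraicComplexity

open _root_.Literature.AlgebraicGeometry.Motives.SmoothHypersurface

section Mumford

variable {n D : ℕ}

/-- The degree-`D` coefficient vector of the polynomial shadow of a tensor depends continuously on
the tensor (each coefficient is a finite sum of coordinates, `coeff_tensorToPoly`). [folklore] -/
private theorem continuous_formCoeff_tensorToPoly {σ : Type*} [Fintype σ] [DecidableEq σ] {m : ℕ} :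
    Continuous fun S : (Fin m → σ) → ℂ => formCoeff m (tensorToPoly S) := by
  refine continuous_pi fun d => ?_
  simp only [formCoeff_apply, coeff_tensorToPoly]
  exact continuous_finsetSum _ fun j _ => continuous_apply j

/-- **Mumford's stability theorem for smooth forms, relative to a separating invariant** (GIT
Prop. 4.2 in the tree's affine vocabulary): let `F ∈ ℂ[x₀,…,x_{n+1}]` be a form of degree `D ≥ 3`
and let `q` be an `SL_{n+2}`-invariant polynomial function on `Sym^D` vanishing on every singular
form of degree `D`, with `q(F) ≠ 0` (so `F` is nonsingular). Then `F` is polystable (its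
`SL_{n+2}(ℂ)`-orbit is closed). The printed argument: `q` is constant on the orbit closure, whose
points are therefore smooth and have finite stabilisers (Matsumura–Monsky), so no degeneration along
a one-parameter subgroup is possible. [cite: MumfordFogartyKirwan1994, Ch. 4 §2 Prop. 4.2] -/
theorem isPolystable_of_invariant_ne_zero {F : MvPolynomial (Fin (n + 2)) ℂ}
    (hFD : F.IsHomogeneous D) (hD : 3 ≤ D)
    {q : MvPolynomial (DegIdx (Fin (n + 2)) D) ℂ} (hq : IsSLInvariantCoord D q)
    (hqF : aeval (formCoeff D F) q ≠ 0)
    (hqsing : ∀ G : MvPolynomial (Fin (n + 2)) ℂ, G.IsHomogeneous D → ¬ IsNonsingularForm ℂ G →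
      aeval (formCoeff D G) q = 0) :
    IsPolystable F := by
  classical
  -- the symmetric tensor of `F`
  set T₀ : (Fin D → Fin (n + 2)) → ℂ := MS2001Thm73.symTensor D F with hT₀
  have hT₀F : tensorToPoly T₀ = F := MS2001Thm73.tensorToPoly_symTensor hFD
  -- Step 1: the tensor orbit `{g • T₀ | det g = 1}` is classically closed
  have hclosed : IsClosed {S : (Fin D → Fin (n + 2)) → ℂ |
      ∃ g : Matrix (Fin (n + 2)) (Fin (n + 2)) ℂ, g.det = 1 ∧ tensorAct g T₀ = S} := by
    refine isClosed_tensorOrbit_of_closure_noFixedTorus T₀ fun T' hT' e hesum hfix => ?_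
    by_contra he
    -- the invariant `q` is constant `= q(F)` on the orbit, hence on its closure
    set Ψ : ((Fin D → Fin (n + 2)) → ℂ) → ℂ := fun S => aeval (formCoeff D (tensorToPoly S)) q with hΨ
    have hΨcont : Continuous Ψ := by
      have h1 : Continuous fun x : DegIdx (Fin (n + 2)) D → ℂ => eval x q :=
        MvPolynomial.continuous_eval q
      have h2 := h1.comp (continuous_formCoeff_tensorToPoly (σ := Fin (n + 2)) (m := D))
      refine h2.congr fun S => ?_
      rfl
    have hΨorb : ∀ S ∈ {S : (Fin D → Fin (n + 2)) → ℂ |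
        ∃ g : Matrix (Fin (n + 2)) (Fin (n + 2)) ℂ, g.det = 1 ∧ tensorAct g T₀ = S},
        Ψ S = aeval (formCoeff D F) q := by
      rintro _ ⟨g, hg, rfl⟩
      rw [hΨ]
      dsimp only
      rw [tensorToPoly_tensorAct, hT₀F]
      exact hq.aeval_formCoeff_linSubst ⟨g, hg⟩ F
    have hΨT' : Ψ T' = aeval (formCoeff D F) q := by
      have hsub : closure {S : (Fin D → Fin (n + 2)) → ℂ |
          ∃ g : Matrix (Fin (n + 2)) (Fin (n + 2)) ℂ, g.det = 1 ∧ tensorAct g T₀ = S} ⊆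
          Ψ ⁻¹' {aeval (formCoeff D F) q} :=
        closure_minimal (fun S hS => hΨorb S hS) ((isClosed_singleton).preimage hΨcont)
      exact hsub hT'
    -- so the form `G' = tensorToPoly T'` is nonsingular, with finite stabiliser
    set G' : MvPolynomial (Fin (n + 2)) ℂ := tensorToPoly T' with hG'
    have hG'hom : G'.IsHomogeneous D := isHomogeneous_tensorToPoly T'
    have hG'ns : IsNonsingularForm ℂ G' := by
      by_contra hsing
      have h0 := hqsing G' hG'hom hsing
      apply hqF
      rw [← hΨT', hΨ]
      exact h0
    haveI hfin : Finite (linStabilizer G') := finite_linStabilizer_of_isNonsingularForm hG'ns hG'hom hD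
    -- the one-parameter torus `s ↦ diag(exp(s e))` lies in the stabiliser ...
    have hdet : ∀ s : ℝ,
        (Matrix.diagonal fun c : Fin (n + 2) => (Real.exp (s * e c) : ℂ)).det = 1 := fun s =>
      det_diagonal_exp_eq_one hesum s
    set γ : ℝ → GL (Fin (n + 2)) ℂ := fun s =>
      Matrix.SpecialLinearGroup.toGL ⟨Matrix.diagonal fun c : Fin (n + 2) => (Real.exp (s * e c) : ℂ),
        hdet s⟩ with hγ
    have hγcoe : ∀ s : ℝ, ((γ s : GL (Fin (n + 2)) ℂ) : Matrix (Fin (n + 2)) (Fin (n + 2)) ℂ) =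
        Matrix.diagonal fun c : Fin (n + 2) => (Real.exp (s * e c) : ℂ) := fun s => rfl
    have hγmem : ∀ s : ℝ, γ s ∈ linStabilizer G' := by
      intro s
      rw [mem_linStabilizer, linSubstRep_apply, hγcoe, hG', ← tensorToPoly_tensorAct, hfix s]
    -- ... and is injective, since `e ≠ 0`
    obtain ⟨c, hc⟩ : ∃ c, e c ≠ 0 := by
      by_contra hno
      push Not at hno
      exact he (funext hno)
    have hγinj : Function.Injective γ := by
      intro s t hst
      have h := congrArg (fun g : GL (Fin (n + 2)) ℂ => (g : Matrix (Fin (n + 2)) (Fin (n + 2)) ℂ) c c) hst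
      simp only [hγcoe, Matrix.diagonal_apply_eq, Complex.ofReal_inj] at h
      have h' := Real.exp_injective h
      exact mul_right_cancel₀ hc h'
    -- contradiction with finiteness
    have hinf : (Set.range γ).Infinite := Set.infinite_range_of_injective hγinj
    have hsub : Set.range γ ⊆ (linStabilizer G' : Set (GL (Fin (n + 2)) ℂ)) := by
      rintro _ ⟨s, rfl⟩
      exact hγmem s
    exact hinf ((Set.toFinite (linStabilizer G' : Set (GL (Fin (n + 2)) ℂ))).subset hsub)
  -- Step 2: hence the coefficient image of the `SL`-orbit of `F` is closed, i.e. `F` is polystable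
  have himg := isClosed_image_slOrbit_tensorToPoly (T₀ := T₀)
    (fun π j => MS2001Thm73.symTensor_comp_perm F π j) hclosed
  rw [hT₀F] at himg
  exact isPolystable_of_isClosed_image_slOrbit hFD himg

/-- **Almost all forms of degree `D ≥ 3` are polystable** (BI 2017 Prop. 2.10 for `D ≥ 3`, in
`n + 2 ≥ 2` variables): the generic set is `{q ≠ 0}`, `q` the `SL`-invariant separating the Fermat
orbit from the singular forms (`exists_isSLInvariantCoord_fermat_one_singular_zero`; `q ≠ 0` as
`q(ΣX_i^D) = 1`); on it `isPolystable_of_invariant_ne_zero` applies. Mumford's route (GIT Prop. 4.2),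
not the printed Luna-slice argument. [cite: BurgisserIkenmeyer2017, Prop. 2.10] -/
theorem isZariskiGeneric_isPolystable_of_three_le (n : ℕ) (hD : 3 ≤ D) :
    IsZariskiGeneric D (IsPolystable : MvPolynomial (Fin (n + 2)) ℂ → Prop) := by
  obtain ⟨q, hq, hq1, hq0⟩ := exists_isSLInvariantCoord_fermat_one_singular_zero n (D := D) (by omega)
  refine ⟨q, fun h0 => ?_, fun f hf h => isPolystable_of_invariant_ne_zero hf hD hq h hq0⟩
  rw [h0, map_zero] at hq1
  exact zero_ne_one hq1

/-- **BI 2017, Prop. 2.10, DISCHARGED**: "If `D > 1`, then almost all `w ∈ Sym^D ℂ^m` are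
polystable." — `D ≥ 3`, `m ≥ 2` by `isZariskiGeneric_isPolystable_of_three_le` (Mumford's route);
`D = 2` and `m ≤ 1` by the tree's slices (`BI2017_prop_2_10_of_residual`, val-lit p5).
[cite: BurgisserIkenmeyer2017, Prop. 2.10] -/
theorem BI2017_prop_2_10_holds : BI2017_prop_2_10 := by
  refine BI2017_prop_2_10_of_residual fun D m hD hm _ _ => ?_
  obtain ⟨n, rfl⟩ : ∃ n, m = n + 2 := ⟨m - 2, by omega⟩
  exact isZariskiGeneric_isPolystable_of_three_le n hD

/-- **BI 2017, Cor. 3.17, DISCHARGED** ("(1) … `E(w) = a'(w)·ℕ` and `\overline{Gw}` non-normal …;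
(2) for almost all `w` …"), by the tree's bridge `BI2017_cor_3_17_of_prop_2_10` (val-lit t09 g3 /
t13) fed with `BI2017_prop_2_10_holds`. [cite: BurgisserIkenmeyer2017, Cor. 3.17] -/
theorem BI2017_cor_3_17_holds : BI2017_cor_3_17 :=
  BI2017_cor_3_17_of_prop_2_10 BI2017_prop_2_10_holds

end Mumford

end Literature.Computability.AlgebraicComplexity

end
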